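import Summits.MatrixMultiplication.OmegaCensus.SmallFormats.MatMul22nRankGF7Slack4Search
import HarnessLib

/-!
# ω-census family (a): definitional equations of the slack-4 search checker

Cell `pub-omega` (unit `pub-omega-tensor-g15`), topic `Summits/MatrixMultiplication/OmegaCensus` (sub-folder `SmallFormats`).
Framing (verbatim): lottery ticket; floor = certified bounds/negative ranges. HONEST FRAMING: kernel bookkeeping (unfolding equations of
`detDies7` / `srch7` stated with GENERIC arguments, so that proofs rewrite with them instead of asking the kernel to unfold the recursive
checkers at concrete packed columns — which exhausts its memory); nothing here is progress on `ω`.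
-/

namespace Summit.MatrixMultiplication.OmegaCensus.SmallFormats

/-- Equation of `detDies7` at fuel `0`. -/
theorem detDies7_zero (cols : List ℕ) (jj : ℕ) : detDies7 cols 0 jj = false := rfl
/-- Successor equation of `detDies7`. -/
theorem detDies7_succ (cols : List ℕ) (fuel jj : ℕ) :
    detDies7 cols (fuel + 1) jj = (if 21 ≤ jj then false else detBad7 jj cols || detDies7 cols fuel (jj + 1)) := rfl
/-- Equation of `srch7` at fuel `0`. -/
theorem srch7_zero (j : ℕ) (cols : List ℕ) : srch7 0 j cols = false := rfl
/-- Successor equation of `srch7`. -/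
theorem srch7_succ (fuel j : ℕ) (cols : List ℕ) :
    srch7 (fuel + 1) j cols = (if 6 ≤ j then detDies7 cols 15 6 else
      (visited7 j (needKey7 j cols) && (bucket7 j (needKey7 j cols)).all fun e => srch7 fuel (j + 1) (cols ++ [slotPack7 e.1 e.2]))) := rfl

end Summit.MatrixMultiplication.OmegaCensus.SmallFormats
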